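import Literature.Algebra.Homology.OrderedCechPairSystemComplex
import Literature.Algebra.Homology.OrderedCechPairSystemAugment
import HarnessLib

/-!
# The column augmentations of the iterated ordered Čech bicomplex of a complex of pair-systems (Stacks 0BEC, 0133, 012Z)

Layer `Literature/Algebra/Homology` (constructions + proved lemmas; 0 named facts, no instance, no notation; pure homological algebra
over a commutative ring `A`). For a cochain complex of pair-systems `Q : CochainComplex (Finset ι ⥤ Finset κ ⥤ ModuleCat A) ℤ`
(`Algebra/Homology/OrderedCechPairSystemComplex`: corner complex `Γ• = emptyComplex Q = (q ↦ Q^q ∅ ∅)`, `∅`-column bicomplex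
`W' = emptyColBicomplex Q = ((q, a) ↦ Čᵃ(Q^q(·, ∅)))`, iterated bicomplex `cechTricomplex Q = (q ↦ Č•,•(Q^q))` and bicomplex of totals
`V = cechTotBicomplex Q = ((a, m) ↦ Tot_{(q,b)} Čᵃ,ᵇ(Q^q))`) the augmentations from the empty members
(`Algebra/Homology/OrderedCechSystemAugment`, `…PairSystemAugment`) assemble, column by column, into

* **`emptyAugment Q : Γ•[0] ⟶ W'`** (one-row source, `Algebra/Homology/BicomplexSingleRow`; column `q` the augmentation
  `(Q^q ∅ ∅)[0] ⟶ Č•(Q^q(·, ∅))`), `emptyToTotal Q : Γ• ⟶ Tot W'`, and **`quasiIso_emptyToTotal`**: a quasi-isomorphism as soon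
  as every column augmentation is (hypothesis (H2∅)) — the columns criterion
  `TotalQuasiIsoOfBoundedColumns.quasiIso_total_map_of_quasiIso_columns_of_isStrictlyGE`;
* `rowAugment Q a : (W'ᶠˡⁱᵖ)ᵃ[0] ⟶ (cechTricomplex Q)ᶠˡⁱᵖ.X a` (column `q` = the column-`a` augmentation `sysBicomplexAugment (Q^q)`),
  `quasiIso_total_map_rowAugment` under (H2col);
* **`colTotAugment Q : W'ᶠˡⁱᵖ ⟶ V`** (`f a = ιTotalSingleRow ≫ Tot(rowAugment Q a)`; the `a`-squares are the naturality of
  `ιTotalSingleRow` and the squares of `sysBicomplexAugment`), and **`quasiIso_total_map_colTotAugment`** under (H2col) for all `a`.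

All hypotheses are binders; everything is about abstract complexes of pair-systems. Library only (cell `pub-hodge-ring2`,
count-neutral); proves nothing about any crux, route or conjecture. Mathlib searched (pin v4.32): `CochainComplex.ofHom`,
`HomologicalComplex₂.total.map_comp`, `Hom.comm`, `quasiIso_comp` (used).

## References

* The Stacks Project, Tag 0BEC (Künneth: the double Čech complex), Tag 0133 (double complexes with exact columns), Tag 012Z. [StacksProject]
* C. A. Weibel, *An introduction to homological algebra* (1994), 5.6.1–5.6.2, 2.7.3. [Weibel1994]
* U. Görtz, T. Wedhorn, *Algebraic Geometry II* (2023), Lemma 21.65, Lemma 21.75 (pp. 179, 264). [GortzWedhorn2023]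
-/

universe u

open CategoryTheory HomologicalComplex

set_option backward.isDefEq.respectTransparency false

noncomputable section

namespace Literature.Algebra.Homology

namespace OrderedCech

variable {A : Type u} [CommRing A] {ι κ : Type} [LinearOrder ι]
  (Q : CochainComplex (Finset ι ⥤ Finset κ ⥤ ModuleCat.{u} A) ℤ)

/-! ### §1 The corner complex augments the `∅`-column bicomplex -/

/-- **`Γ•[0] ⟶ W'`**: column `q` is the augmentation `(Q^q ∅ ∅)[0] ⟶ Č•(Q^q(·, ∅))` of the `ι`-system `Q^q(·, ∅)` by its empty
member (`sysAugmentHom`); the `q`-squares are `sysAugmentHom_naturality`. [cite: GortzWedhorn2023, Lemma 21.65 (p. 179)]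
[cite: StacksProject, Tag 0BEC] -/
def emptyAugment : singleRowBicomplex (emptyComplex Q) ⟶ emptyColBicomplex Q :=
  CochainComplex.ofHom (fun q => sysAugmentHom ((Q.X q).flip.obj ∅)) fun q =>
    (sysAugmentHom_naturality (((flipFunctor _ _ _).map (Q.d q (q + 1))).app ∅)).symm

/-- The columns of `emptyAugment` (`rfl`). [cite: StacksProject, Tag 0BEC] -/
@[simp] theorem emptyAugment_f (q : ℤ) : (emptyAugment Q).f q = sysAugmentHom ((Q.X q).flip.obj ∅) := rfl

/-- **`Γ• ⟶ Tot W'`**: the corner complex maps to the total complex of the `∅`-column bicomplex (`Γ• ≅ Tot(Γ•[0])`, then `Tot` of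
`emptyAugment`). [cite: StacksProject, Tag 0BEC] [cite: StacksProject, Tag 012Z] -/
def emptyToTotal : emptyComplex Q ⟶ (emptyColBicomplex Q).total (ComplexShape.up ℤ) :=
  ιTotalSingleRow (emptyComplex Q) ≫ HomologicalComplex₂.total.map (emptyAugment Q) (ComplexShape.up ℤ)

/-- `Tot(emptyAugment)` is a quasi-isomorphism when every column augmentation is (hypothesis (H2∅)), for `Q` in degrees `≥ 0`.
[cite: StacksProject, Tag 0133] [cite: Weibel1994, 5.6.1–5.6.2] -/
theorem quasiIso_total_map_emptyAugment [Q.IsStrictlyGE 0]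
    (h : ∀ q : ℤ, QuasiIso (sysAugmentHom ((Q.X q).flip.obj ∅))) :
    QuasiIso (HomologicalComplex₂.total.map (emptyAugment Q) (ComplexShape.up ℤ)) := by
  haveI := isStrictlyGE_emptyComplex Q 0
  haveI := isStrictlyGE_singleRowBicomplex (emptyComplex Q) 0
  haveI := isStrictlyGE_emptyColBicomplex Q 0
  exact quasiIso_total_map_of_quasiIso_columns_of_isStrictlyGE _ _ (emptyAugment Q) 0 0
    (fun q => isStrictlyGE_singleRowBicomplex_X _ q) (fun q => isStrictlyGE_emptyColBicomplex_X Q q) fun q => h q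

/-- **`Γ• ⟶ Tot W'` is a quasi-isomorphism under (H2∅)** (every `ι`-system `Q^q(·, ∅)` is Čech-resolved by its empty member `Q^q ∅ ∅`),
for `Q` in degrees `≥ 0`. [cite: StacksProject, Tag 0BEC] [cite: StacksProject, Tag 0133] -/
theorem quasiIso_emptyToTotal [Q.IsStrictlyGE 0] (h : ∀ q : ℤ, QuasiIso (sysAugmentHom ((Q.X q).flip.obj ∅))) :
    QuasiIso (emptyToTotal Q) := by
  haveI := isIso_ιTotalSingleRow (emptyComplex Q)
  haveI := quasiIso_total_map_emptyAugment Q h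
  unfold emptyToTotal
  infer_instance

/-! ### §2 The `∅`-columns augment the columns of the iterated bicomplex -/

variable [LinearOrder κ]

/-- The `a`-differential of `cechTotBicomplex Q` is `Tot` of the `a`-differential of the flip (`rfl`). [cite: StacksProject, Tag 012Z] -/
theorem cechTotBicomplex_d (a a' : ℤ) :
    (cechTotBicomplex Q).d a a' = HomologicalComplex₂.total.map ((cechTricomplex Q).flip.d a a') (ComplexShape.up ℤ) := rfl

/-- For each `σ`-degree `a`: **`(q ↦ Čᵃ(Q^q(·, ∅)))[0] ⟶ (q ↦ Č^{a,•}(Q^q))`**, column `q` the column-`a` augmentation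
`Čᵃ(Q^q(·, ∅))[0] ⟶ Č•(cochainSystem (Q^q) a)` (`(sysBicomplexAugment (Q^q)).f a`); the `q`-squares are `sysAugmentHom_naturality`
at `cochainSystemMap (d_Q) a`. [cite: StacksProject, Tag 0BEC] [cite: GortzWedhorn2023, Lemma 21.75 (p. 264)] -/
def rowAugment (a : ℤ) : singleRowBicomplex ((emptyColBicomplex Q).flip.X a) ⟶ (cechTricomplex Q).flip.X a :=
  CochainComplex.ofHom (fun q => sysAugmentHom (cochainSystem (Q.X q) a)) fun q =>
    (sysAugmentHom_naturality (cochainSystemMap (Q.d q (q + 1)) a)).symm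

/-- The columns of `rowAugment` (`rfl`). [cite: StacksProject, Tag 0BEC] -/
@[simp] theorem rowAugment_f (a q : ℤ) : (rowAugment Q a).f q = sysAugmentHom (cochainSystem (Q.X q) a) := rfl

/-- `Tot(rowAugment Q a)` is a quasi-isomorphism when the column-`a` augmentations of all `Č•,•(Q^q)` are (hypothesis (H2col)), for
`Q` in degrees `≥ 0`. [cite: StacksProject, Tag 0133] [cite: Weibel1994, 5.6.1–5.6.2] -/
theorem quasiIso_total_map_rowAugment [Q.IsStrictlyGE 0] (a : ℤ)
    (h : ∀ q : ℤ, QuasiIso (sysAugmentHom (cochainSystem (Q.X q) a))) :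
    QuasiIso (HomologicalComplex₂.total.map (rowAugment Q a) (ComplexShape.up ℤ)) := by
  haveI := isStrictlyGE_emptyColBicomplex_flip_X Q 0 a
  haveI := isStrictlyGE_singleRowBicomplex ((emptyColBicomplex Q).flip.X a) 0
  haveI := isStrictlyGE_cechTricomplex_flip_X Q 0 a
  exact quasiIso_total_map_of_quasiIso_columns_of_isStrictlyGE _ _ (rowAugment Q a) 0 0
    (fun q => isStrictlyGE_singleRowBicomplex_X _ q) (fun q => isStrictlyGE_sysBicomplex_X (Q.X q) a) fun q => h q

/-! ### §3 Assembling over `a`: `W'ᶠˡⁱᵖ ⟶ V` -/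

/-- The `a`-squares of the `rowAugment`s: they intertwine the `σ`-differentials (column by column this is the square of
`sysBicomplexAugment (Q^q)`). [cite: StacksProject, Tag 0BEC] -/
theorem rowAugment_comm (a : ℤ) :
    rowAugment Q a ≫ (cechTricomplex Q).flip.d a (a + 1) =
      (singleRowFunctor _).map ((emptyColBicomplex Q).flip.d a (a + 1)) ≫ rowAugment Q (a + 1) :=
  HomologicalComplex.hom_ext _ _ fun q => by
    rw [comp_f, comp_f, rowAugment_f, rowAugment_f]
    exact (sysBicomplexAugment (Q.X q)).comm a (a + 1)

/-- **`W'ᶠˡⁱᵖ ⟶ V`**: in column `a`, `(q ↦ Čᵃ(Q^q(·, ∅))) ≅ Tot((q ↦ Čᵃ(Q^q(·, ∅)))[0]) ⟶ Tot_{(q,b)} Čᵃ,ᵇ(Q^q)`; the `a`-squares are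
the naturality of `ιTotalSingleRow` (`Algebra/Homology/BicomplexSingleRow`) and `rowAugment_comm`.
[cite: StacksProject, Tag 0BEC] [cite: StacksProject, Tag 012Z] -/
def colTotAugment : (emptyColBicomplex Q).flip ⟶ cechTotBicomplex Q where
  f a := ιTotalSingleRow ((emptyColBicomplex Q).flip.X a) ≫
    HomologicalComplex₂.total.map (rowAugment Q a) (ComplexShape.up ℤ)
  comm' a a' haa' := by
    obtain rfl : a + 1 = a' := haa'
    rw [cechTotBicomplex_d, Category.assoc, ← HomologicalComplex₂.total.map_comp, rowAugment_comm,
      HomologicalComplex₂.total.map_comp, ← Category.assoc, ← ιTotalSingleRow_naturality, Category.assoc]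

/-- The columns of `colTotAugment` (`rfl`). [cite: StacksProject, Tag 0BEC] -/
@[simp] theorem colTotAugment_f (a : ℤ) :
    (colTotAugment Q).f a = ιTotalSingleRow ((emptyColBicomplex Q).flip.X a) ≫
      HomologicalComplex₂.total.map (rowAugment Q a) (ComplexShape.up ℤ) := rfl

/-- The columns of `colTotAugment` are quasi-isomorphisms under (H2col). [cite: StacksProject, Tag 0133] -/
theorem quasiIso_colTotAugment_f [Q.IsStrictlyGE 0] (a : ℤ)
    (h : ∀ q : ℤ, QuasiIso (sysAugmentHom (cochainSystem (Q.X q) a))) : QuasiIso ((colTotAugment Q).f a) := by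
  haveI := isIso_ιTotalSingleRow ((emptyColBicomplex Q).flip.X a)
  haveI := quasiIso_total_map_rowAugment Q a h
  rw [colTotAugment_f]
  infer_instance

/-- **`Tot(W'ᶠˡⁱᵖ) ⟶ Tot V` is a quasi-isomorphism under (H2col) for all `a`** (every column of every `Č•,•(Q^q)` is Čech-resolved by
its empty member), for `Q` in degrees `≥ 0`: the columns criterion once more. [cite: StacksProject, Tag 0133] [cite: Weibel1994, 5.6.1–5.6.2] -/
theorem quasiIso_total_map_colTotAugment [Q.IsStrictlyGE 0]
    (h : ∀ q a : ℤ, QuasiIso (sysAugmentHom (cochainSystem (Q.X q) a))) :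
    QuasiIso (HomologicalComplex₂.total.map (colTotAugment Q) (ComplexShape.up ℤ)) := by
  haveI := isStrictlyGE_emptyColBicomplex_flip Q
  haveI := isStrictlyGE_cechTotBicomplex Q
  exact quasiIso_total_map_of_quasiIso_columns_of_isStrictlyGE _ _ (colTotAugment Q) 0 0
    (fun a => isStrictlyGE_emptyColBicomplex_flip_X Q 0 a) (fun a => isStrictlyGE_cechTotBicomplex_X Q a)
    fun a => quasiIso_colTotAugment_f Q a fun q => h q a

end OrderedCech

end Literature.Algebra.Homology

end
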